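import Mathlib.Analysis.SpecialFunctions.Pow.Real
import Literature.Probability.Percolation.SitePercolationMeasure
import Literature.Probability.Percolation.SiteConnectionTools
import Literature.Probability.Percolation.CerfTwoArms
import Literature.Probability.Percolation.CerfBoxLROProofs
import Literature.Probability.Percolation.CerfLem71Proofs
import Literature.Probability.Percolation.CerfCentralInequality
import HarnessLib

/-!
# Cerf 2015, §8 (control on the number of arms): the recursive inequality of §8–§9

Topic `Literature/Probability/Percolation`. Sorry-free derivation of the named fact
`Literature.Probability.Percolation.Cerf2015_sec9_recursion` (`CerfCentralInequality.lean`) from the central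
inequality `Cerf2015_lem_5_1`, the box two-arms bound `Cerf2015_cor_7_2` (`CerfTwoArms.lean`,
discharged in `CerfCor72Proofs.lean`) and the connection lower bound
`Cerf2015_lem_6_1_of_siteTheta_pos` (discharged in `CerfLem61Proofs.lean`), following §8
(p. 12–13) and the first display of §9 (p. 14) of R. Cerf, *A lower bound on the two-arms
exponent for critical percolation on the lattice*, Ann. Probab. 43 (2015) 2458–2480,
doi:10.1214/14-AOP940 (arXiv:1306.3105; page numbers refer to the 16-page arXiv rendering).
Combined with `CerfIterationProofs.Cerf2015_thm_1_3_of_recursion` this reduces Theorem 1.3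
(`Cerf2015_thm_1_3`) to Lemma 5.1.

## The argument (§8, p. 12–13), as formalised

Fix `n ≥ 2`, `1 ≤ k ≤ n − 3`, `ℓ = n`, `L = Λ(2n)`, `Λ' = Λ(n+1)` and Cerf's (repaired) collection
`𝒞 = reachingClusters (zdGraph d) L Λ'` of the open clusters of `L` meeting `Λ'` and `∂ⁱⁿL`
(`CerfCentralInequality.lean`, module docstring).

1. `exists_grid`, `exists_boxCovering`: `∂ⁱⁿΛ(N)` is covered by a family `(v + Λ(k))_{v ∈ I}`
   of translates of `Λ(k)` included in `Λ(N)` with `|I| ≤ 2d (3N/k)^{d−1}` (p. 12: "there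
   exists such a covering whose cardinality satisfies `|I| ≤ 2d(2n/k)^{d−1}`"; any bound
   `c(d)(N/k)^{d−1}` serves).
2. Every `C ∈ 𝒞` meets `∂ⁱⁿΛ'` (exit lemma), hence some box `v + Λ(k)`; a box meets at most
   `|∂ⁱⁿΛ(k)|` clusters of `𝒞` (distinct clusters are disjoint and each crosses the inner
   boundary of the box, `card_filter_meets_le`); and if two distinct clusters of `𝒞` meet
   `v + Λ(k)` then, restricted to `v + Λ(k+m) ⊆ L`, they realise a translate of
   `two-arms(Λ(k), m)` (`relabel_mem_siteTwoArmsBox_of_two_clusters`), `m = n − 1`. Hence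
   (p. 13) `|𝒞| ≤ |I| + |∂ⁱⁿΛ(k)| Σ_{v ∈ I} 1_{v + Λ(k) is bad}` pointwise
   (`card_reachingClusters_le`).
3. Taking expectations, with `E(√|𝒞|) ≤ E(|𝒞|)^{1/2}` in the elementary form
   `√N ≤ N/(2M) + M/2` (`integral_sqrt_le_sqrt_of_le_indicator_sum`, the bad-box events being
   replaced by measurable hulls, so that no measurability of `|𝒞|` is needed), translation
   invariance (`sitePercolation_real_preimage_relabel`) and Cor. 7.2 (boxes `Λ(k)`, `ℓ = n − 1`)
   with Lemma 6.1 (`q = c₆ k^{−2(d−1)d}`) for the bad boxes: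
   `E(√|𝒞|) ≤ (c₃ n^{d−1} (k^{−(d−1)} + k^{2d²+2d−2} P(two-arms(0, n−k−2))))^{1/2}`.
4. Lemma 5.1 with `ℓ = n`, `|Λ(n)| ≥ n^d` (`first_term_le`), and the absorption of its second
   (super-polynomially small) term, `n^{3d} e^{−2a (ln n)²} ≤ e^{9d²/(8a)}`, `a = p²(1−p)²`
   (`pow_mul_exp_neg_log_sq_le`, `card_box_sq_mul_exp_le`, `div_pow_le_log_div_sqrt_mul_sqrt`),
   give `Cerf2015_sec9_recursion` with
   `c = 2d √c₃ + (4d 16^d e^{9d²/(8a)}/(p(1−p)))/ln 2` (`Cerf2015_sec9_recursion_of_lemmas`).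

## Main results

* `exists_boxCovering`, `card_filter_meets_le`, `card_reachingClusters_le`,
  `integral_sqrt_le_sqrt_of_le_indicator_sum`;
* `Cerf2015_sec9_recursion_of_lemmas :
    Cerf2015_lem_5_1 → Cerf2015_cor_7_2 → Cerf2015_lem_6_1_of_siteTheta_pos →
    Cerf2015_sec9_recursion`.

With `Cerf2015_cor_7_2_holds` (`CerfCor72Proofs.lean`) and
`Cerf2015_lem_6_1_of_siteTheta_pos_holds` (`CerfLem61Proofs.lean`) — not imported here only
because this file was checked before their build — and `Cerf2015_thm_1_3_of_recursion`
(`CerfIterationProofs.lean`), Theorem 1.3 follows from `Cerf2015_lem_5_1` alone.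

## References

* R. Cerf, Ann. Probab. 43 (2015) 2458–2480, arXiv:1306.3105, §8 (p. 12–13), §9 (p. 14).
-/

noncomputable section

open MeasureTheory Literature.Probability.LatticeModels Literature.Probability.Percolation
open scoped Finset

namespace Literature.Probability.Percolation

section CritPerc

variable {V : Type*} {d : ℕ}

/-! ### Step 1: covering the inner boundary of a box by translates of a smaller box -/

/-- **One-dimensional grid**: for `1 ≤ k ≤ N` there is a set `T` of at most `2N/k + 1` integers
in `[−(N−k), N−k]` such that every integer of `[−N, N]` is within distance `k` of `T`.
[cite: Cerf2015, §8 p. 12] -/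
theorem exists_grid {N k : ℕ} (hk : 1 ≤ k) (hkN : k ≤ N) :
    ∃ T : Finset ℤ, (∀ c ∈ T, -((N : ℤ) - k) ≤ c ∧ c ≤ (N : ℤ) - k) ∧
      (∀ t : ℤ, -(N : ℤ) ≤ t → t ≤ N → ∃ c ∈ T, -(k : ℤ) ≤ t - c ∧ t - c ≤ k) ∧
      #T ≤ 2 * N / k + 1 := by
  have hkN' : (k : ℤ) ≤ N := by exact_mod_cast hkN
  refine ⟨(Finset.range (2 * N / k + 1)).image fun j : ℕ =>
      max (-((N : ℤ) - k)) (min (-(N : ℤ) + k * j) ((N : ℤ) - k)), ?_, ?_, ?_⟩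
  · intro c hc
    obtain ⟨j, -, rfl⟩ := Finset.mem_image.1 hc
    exact ⟨le_max_left _ _, max_le (by linarith) (min_le_right _ _)⟩
  · intro t ht1 ht2
    obtain ⟨a, ha⟩ : ∃ a : ℕ, (a : ℤ) = t + N := ⟨(t + N).toNat, Int.toNat_of_nonneg (by linarith)⟩
    have haN : a ≤ 2 * N := by
      have : (a : ℤ) ≤ 2 * N := by rw [ha]; linarith
      exact_mod_cast this
    refine ⟨_, Finset.mem_image.2 ⟨a / k, ?_, rfl⟩, ?_⟩
    · exact Finset.mem_range.2 (Nat.lt_succ_of_le (Nat.div_le_div_right haN))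
    · have h1 : k * (a / k) + a % k = a := Nat.div_add_mod a k
      have h2 : a % k < k := Nat.mod_lt _ (by omega)
      have h1' : ((k : ℤ) * ((a / k : ℕ) : ℤ)) + ((a % k : ℕ) : ℤ) = t + N := by
        rw [← ha]; exact_mod_cast h1
      have h2' : ((a % k : ℕ) : ℤ) < k := by exact_mod_cast h2
      have h3' : (0 : ℤ) ≤ ((a % k : ℕ) : ℤ) := by positivity
      generalize ((a / k : ℕ) : ℤ) = q at h1' ⊢
      generalize ((a % k : ℕ) : ℤ) = r at h1' h2' h3'
      have hq : (k : ℤ) * q = t + N - r := by linarith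
      rw [hq]
      rw [max_def, min_def]
      split_ifs <;> constructor <;> linarith
  · exact Finset.card_image_le.trans (by rw [Finset.card_range])

/-- **The covering of §8** (p. 12: "Let `Λ_i, i ∈ I`, be a collection of boxes which are
translates of `Λ(k)`, which are included in `Λ(n)` and which covers the inner boundary
`∂ⁱⁿΛ(n)` … there exists such a covering whose cardinality satisfies
`|I| ≤ 2d(2n/k)^{d−1}`"): for `d ≥ 1` and `1 ≤ k ≤ N` there is a set `I ⊆ Λ(N−k)` of centres
with `∂ⁱⁿΛ(N) ⊆ ⋃_{v ∈ I} (v + Λ(k))` and `|I| ≤ 2d(3N/k)^{d−1}` (grid centres on the `2d`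
faces). [cite: Cerf2015, §8 p. 12] -/
theorem exists_boxCovering (hd : 1 ≤ d) {N k : ℕ} (hk : 1 ≤ k) (hkN : k ≤ N) :
    ∃ I : Finset (Site d), (∀ v ∈ I, v ∈ box d (N - k)) ∧
      (∀ x ∈ innerBoundary (zdGraph d) (box d N), ∃ v ∈ I, x ∈ shiftedBox v k) ∧
      (#I : ℝ) ≤ 2 * d * (3 * (N : ℝ) / k) ^ (d - 1) := by
  classical
  obtain ⟨T, hT1, hT2, hT3⟩ := exists_grid hk hkN
  have hkN' : (k : ℤ) ≤ N := by exact_mod_cast hkN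
  have hcast : ((N - k : ℕ) : ℤ) = (N : ℤ) - k := Nat.cast_sub hkN
  set E : Finset ℤ := {(N : ℤ) - k, -((N : ℤ) - k)} with hE
  set I : Finset (Site d) := Finset.univ.biUnion fun j : Fin d =>
    Fintype.piFinset fun i => if i = j then E else T with hI
  refine ⟨I, ?_, ?_, ?_⟩
  · -- centres lie in `Λ(N − k)`
    intro v hv
    simp only [hI, Finset.mem_biUnion, Finset.mem_univ, true_and, Fintype.mem_piFinset] at hv
    obtain ⟨j, hj⟩ := hv
    rw [mem_box]
    intro i
    rw [hcast]
    have := hj i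
    split_ifs at this with hij
    · rw [hE, Finset.mem_insert, Finset.mem_singleton] at this
      rcases this with h | h <;> rw [h] <;> constructor <;> linarith
    · exact hT1 _ this
  · -- covering
    intro x hx
    have hxbox : x ∈ box d N := (mem_innerBoundary_iff.1 hx).1
    rw [mem_box] at hxbox
    obtain ⟨j, hj⟩ := exists_eq_of_mem_innerBoundary_box hx
    have hc : ∀ i, ∃ c ∈ T, -(k : ℤ) ≤ x i - c ∧ x i - c ≤ k :=
      fun i => hT2 (x i) (hxbox i).1 (hxbox i).2
    choose c hcT hc1 hc2 using hc
    set v : Site d := fun i => if i = j then (if x j = N then (N : ℤ) - k else -((N : ℤ) - k))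
      else c i with hv
    refine ⟨v, ?_, ?_⟩
    · simp only [hI, Finset.mem_biUnion, Finset.mem_univ, true_and, Fintype.mem_piFinset]
      refine ⟨j, fun i => ?_⟩
      by_cases hij : i = j
      · subst hij
        simp only [hv, if_true]
        rw [hE]
        split_ifs
        · exact Finset.mem_insert_self _ _
        · exact Finset.mem_insert_of_mem (Finset.mem_singleton_self _)
      · simp only [hv, hij, if_false]
        exact hcT i
    · rw [mem_shiftedBox_iff, mem_box]
      intro i
      simp only [Pi.sub_apply, hv]
      by_cases hij : i = j
      · subst hij
        simp only [if_true]
        rcases hj with h | h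
        · rw [if_pos h, h]; constructor <;> linarith
        · have hne : ¬ x i = N := by
            rw [h]; intro h'; have : (N : ℤ) = 0 := by linarith
            have : (1 : ℤ) ≤ N := by exact_mod_cast hk.trans hkN
            linarith
          rw [if_neg hne, h]; constructor <;> linarith
      · simp only [hij, if_false]
        exact ⟨hc1 i, hc2 i⟩
  · -- cardinality
    have hcardE : #E ≤ 2 := Finset.card_le_two
    have hpi : ∀ j : Fin d, #(Fintype.piFinset fun i => if i = j then E else T) ≤ 2 * #T ^ (d - 1) := by
      intro j
      rw [Fintype.card_piFinset]
      simp only [apply_ite Finset.card]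
      rw [Finset.prod_ite, Finset.prod_const, Finset.prod_const, Finset.filter_eq' Finset.univ j,
        if_pos (Finset.mem_univ j), Finset.card_singleton, pow_one, Finset.filter_ne' Finset.univ j,
        Finset.card_erase_of_mem (Finset.mem_univ j), Finset.card_univ, Fintype.card_fin]
      exact Nat.mul_le_mul_right _ hcardE
    have hIcard : #I ≤ d * (2 * #T ^ (d - 1)) := by
      calc #I ≤ ∑ j : Fin d, #(Fintype.piFinset fun i => if i = j then E else T) :=
            Finset.card_biUnion_le
        _ ≤ ∑ _j : Fin d, 2 * #T ^ (d - 1) := Finset.sum_le_sum fun j _ => hpi j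
        _ = d * (2 * #T ^ (d - 1)) := by
            rw [Finset.sum_const, Finset.card_univ, Fintype.card_fin, smul_eq_mul]
    have hk0 : (0 : ℝ) < k := by exact_mod_cast hk
    have hNk : (1 : ℝ) ≤ (N : ℝ) / k := by
      rw [le_div_iff₀ hk0, one_mul]; exact_mod_cast hkN
    have hT3' : (#T : ℝ) ≤ 3 * (N : ℝ) / k := by
      have h1 : (#T : ℝ) ≤ ((2 * N / k : ℕ) : ℝ) + 1 := by exact_mod_cast hT3
      have h2 : ((2 * N / k : ℕ) : ℝ) ≤ 2 * (N : ℝ) / k := by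
        have := Nat.cast_div_le (m := 2 * N) (n := k) (α := ℝ)
        push_cast at this
        exact this
      calc (#T : ℝ) ≤ 2 * (N : ℝ) / k + 1 := by linarith
        _ ≤ 2 * (N : ℝ) / k + (N : ℝ) / k := by linarith
        _ = 3 * (N : ℝ) / k := by ring
    calc (#I : ℝ) ≤ ((d * (2 * #T ^ (d - 1)) : ℕ) : ℝ) := by exact_mod_cast hIcard
      _ = 2 * d * (#T : ℝ) ^ (d - 1) := by push_cast; ring
      _ ≤ 2 * d * (3 * (N : ℝ) / k) ^ (d - 1) := by gcongr


/-! ### Step 2: combinatorics of the collection `𝒞 = reachingClusters G L Λ` -/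

section Clusters

variable {G : SimpleGraph V} [DecidableEq V] [G.LocallyFinite] {L Λ : Finset V}
  {ω : SiteConfig V}

open Classical in
/-- A member of `𝒞` is the restricted cluster `C_L(x)` of a site `x ∈ Λ` joined to `∂ⁱⁿL`.
[cite: Cerf2015, §2–§3] -/
theorem exists_root_of_mem_reachingClusters {C : Finset V} (hC : C ∈ reachingClusters G L Λ ω) :
    ∃ x ∈ Λ, (∃ w ∈ innerBoundary G L, w ∈ siteClusterIn G ↑L ω x) ∧
      ∀ y, y ∈ C ↔ y ∈ siteClusterIn G ↑L ω x := by
  obtain ⟨x, hx, hw, hCx⟩ := mem_reachingClusters_iff.1 hC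
  refine ⟨x, hx, hw, fun y => ?_⟩
  rw [← hCx, Finset.mem_filter]
  exact ⟨fun h => h.2, fun h => ⟨siteClusterIn_subset G ↑L ω x h, h⟩⟩

/-- A member of `𝒞` is the restricted cluster of each of its sites. [cite: Cerf2015, §2–§3] -/
theorem mem_iff_of_mem_reachingClusters {C : Finset V} (hC : C ∈ reachingClusters G L Λ ω)
    {a : V} (ha : a ∈ C) (y : V) : y ∈ C ↔ y ∈ siteClusterIn G ↑L ω a := by
  obtain ⟨x, -, -, hCx⟩ := exists_root_of_mem_reachingClusters hC
  have hax : a ∈ siteClusterIn G ↑L ω x := (hCx a).1 ha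
  rw [hCx]
  exact ⟨fun hy => siteConnIn_of_mem_siteClusterIn hax hy,
    fun hy => mem_siteClusterIn_of_siteConnIn hax hy⟩

/-- **Distinct clusters are disjoint**: two members of `𝒞` sharing a site are equal.
[cite: Cerf2015, §2–§3] -/
theorem eq_of_mem_reachingClusters_of_mem {C₁ C₂ : Finset V}
    (h₁ : C₁ ∈ reachingClusters G L Λ ω) (h₂ : C₂ ∈ reachingClusters G L Λ ω) {y : V}
    (hy₁ : y ∈ C₁) (hy₂ : y ∈ C₂) : C₁ = C₂ := by
  ext z
  rw [mem_iff_of_mem_reachingClusters h₁ hy₁, mem_iff_of_mem_reachingClusters h₂ hy₂]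

/-- **Exit through a sub-region** (exit lemma): if `C ∈ 𝒞` contains a site `a` of `B ⊆ L`, then
`C` contains a site `b` of `∂ⁱⁿB` joined to `a` inside `B` (`C` goes all the way to `∂ⁱⁿL`).
[cite: Cerf2015, §8 p. 13] -/
theorem exists_mem_innerBoundary_of_mem_reachingClusters {C : Finset V}
    (hC : C ∈ reachingClusters G L Λ ω) {B : Finset V} (hBL : B ⊆ L) {a : V} (haC : a ∈ C)
    (haB : a ∈ B) : ∃ b ∈ innerBoundary G B, b ∈ C ∧ ω ∈ siteConnIn G ↑B a b := by
  obtain ⟨x, -, ⟨w, hw, hwx⟩, hCx⟩ := exists_root_of_mem_reachingClusters hC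
  have hax : a ∈ siteClusterIn G ↑L ω x := (hCx a).1 haC
  have haw : ω ∈ siteConnIn G ↑L a w := siteConnIn_of_mem_siteClusterIn hax hwx
  obtain ⟨b, hb, hab⟩ := exists_innerBoundary_siteConnIn_of_subset hBL haB hw haw
  refine ⟨b, hb, ?_, hab⟩
  rw [hCx]
  exact mem_siteClusterIn_of_siteConnIn hax
    (siteConnIn_mono_set G (Finset.coe_subset.2 hBL) a b hab)

/-- Every member of `𝒞` meets `∂ⁱⁿΛ` when `Λ ⊆ L` (p. 13: "The clusters of the collection `𝒞`
intersect `∂ⁱⁿΛ(n)`"). [cite: Cerf2015, §8 p. 13] -/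
theorem exists_mem_innerBoundary_of_mem_reachingClusters' (hΛL : Λ ⊆ L) {C : Finset V}
    (hC : C ∈ reachingClusters G L Λ ω) : ∃ b ∈ innerBoundary G Λ, b ∈ C := by
  obtain ⟨x, hx, ⟨w, -, hwx⟩, hCx⟩ := exists_root_of_mem_reachingClusters hC
  have hxC : x ∈ C := (hCx x).2 (root_mem_siteClusterIn hwx)
  obtain ⟨b, hb, hbC, -⟩ := exists_mem_innerBoundary_of_mem_reachingClusters hC hΛL hxC hx
  exact ⟨b, hb, hbC⟩

/-- **A box meets at most `|∂ⁱⁿB|` clusters of `𝒞`** (p. 13: "a bad box … meets at most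
`|∂ⁱⁿΛ(k)|` clusters of `𝒞`"): distinct members are disjoint and each one meeting `B ⊆ L`
contains a site of `∂ⁱⁿB`. [cite: Cerf2015, §8 p. 13] -/
theorem card_filter_meets_le {B : Finset V} (hBL : B ⊆ L) :
    #((reachingClusters G L Λ ω).filter fun C => (C ∩ B).Nonempty) ≤ #(innerBoundary G B) := by
  have key : ∀ C ∈ (reachingClusters G L Λ ω).filter fun C => (C ∩ B).Nonempty,
      ∃ b ∈ innerBoundary G B, b ∈ C := by
    intro C hC
    rw [Finset.mem_filter] at hC
    obtain ⟨a, ha⟩ := hC.2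
    rw [Finset.mem_inter] at ha
    obtain ⟨b, hb, hbC, -⟩ :=
      exists_mem_innerBoundary_of_mem_reachingClusters hC.1 hBL ha.1 ha.2
    exact ⟨b, hb, hbC⟩
  rcases ((reachingClusters G L Λ ω).filter fun C => (C ∩ B).Nonempty).eq_empty_or_nonempty
    with h0 | ⟨C₀, hC₀⟩
  · rw [h0, Finset.card_empty]; exact Nat.zero_le _
  obtain ⟨a₀, -⟩ := (Finset.mem_filter.1 hC₀).2
  haveI : Nonempty V := ⟨a₀⟩
  choose! f hf hfC using key
  refine Finset.card_le_card_of_injOn f (fun C hC => hf C hC) ?_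
  intro C₁ hC₁ C₂ hC₂ hEq
  have h₁ := hfC C₁ hC₁
  have h₂ := hfC C₂ hC₂
  rw [hEq] at h₁
  exact eq_of_mem_reachingClusters_of_mem (Finset.mem_filter.1 (Finset.mem_coe.1 hC₁)).1
    (Finset.mem_filter.1 (Finset.mem_coe.1 hC₂)).1 h₁ h₂

/-- **Two clusters in one box give two arms** (p. 13: "If two clusters of `𝒞` intersect the
same box `Λ_i`, this box has to be bad, because these two clusters go all the way till
`∂ⁱⁿΛ(n+ℓ)`"): if distinct `C₁, C₂ ∈ 𝒞` contain sites `a₁, a₂` of `W ⊆ L`, then inside `W`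
the clusters of `a₁, a₂` are disjoint and both reach `∂ⁱⁿW`. [cite: Cerf2015, §8 p. 13] -/
theorem twoArms_of_two_mem_reachingClusters {C₁ C₂ : Finset V}
    (h₁ : C₁ ∈ reachingClusters G L Λ ω) (h₂ : C₂ ∈ reachingClusters G L Λ ω) (hne : C₁ ≠ C₂)
    {W : Finset V} (hWL : W ⊆ L) {a₁ a₂ : V} (ha₁ : a₁ ∈ C₁) (ha₁W : a₁ ∈ W) (ha₂ : a₂ ∈ C₂)
    (ha₂W : a₂ ∈ W) :
    Disjoint (siteClusterIn G ↑W ω a₁) (siteClusterIn G ↑W ω a₂) ∧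
      (∃ b ∈ innerBoundary G W, b ∈ siteClusterIn G ↑W ω a₁) ∧
      (∃ b ∈ innerBoundary G W, b ∈ siteClusterIn G ↑W ω a₂) := by
  refine ⟨?_, ?_, ?_⟩
  · rw [Set.disjoint_left]
    intro z hz₁ hz₂
    have hz₁' : z ∈ C₁ := (mem_iff_of_mem_reachingClusters h₁ ha₁ z).2
      (siteConnIn_mono_set G (Finset.coe_subset.2 hWL) a₁ z hz₁)
    have hz₂' : z ∈ C₂ := (mem_iff_of_mem_reachingClusters h₂ ha₂ z).2
      (siteConnIn_mono_set G (Finset.coe_subset.2 hWL) a₂ z hz₂)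
    exact hne (eq_of_mem_reachingClusters_of_mem h₁ h₂ hz₁' hz₂')
  · obtain ⟨b, hb, -, hab⟩ := exists_mem_innerBoundary_of_mem_reachingClusters h₁ hWL ha₁ ha₁W
    exact ⟨b, hb, hab⟩
  · obtain ⟨b, hb, -, hab⟩ := exists_mem_innerBoundary_of_mem_reachingClusters h₂ hWL ha₂ ha₂W
    exact ⟨b, hb, hab⟩

end Clusters

/-! ### Step 3: the pointwise bound `|𝒞| ≤ |I| + |∂ⁱⁿΛ(k)| · #{bad boxes}` on `ℤ^d` -/

section Pointwise

/-- **Bad boxes are translates of `two-arms(Λ(k), m)`**: if the clusters of `a₁, a₂ ∈ v + Λ(k)`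
inside `v + Λ(k+m)` are disjoint and reach the inner boundary, then the configuration
translated by `−v` lies in `two-arms(Λ(k), m)`. [cite: Cerf2015, §8 p. 13] -/
theorem relabel_mem_siteTwoArmsBox {v a₁ a₂ : Site d} {k m : ℕ} {ω : SiteConfig (Site d)}
    (ha₁ : a₁ ∈ shiftedBox v k) (ha₂ : a₂ ∈ shiftedBox v k)
    (h : Disjoint (siteClusterIn (zdGraph d) ↑(shiftedBox v (k + m)) ω a₁)
          (siteClusterIn (zdGraph d) ↑(shiftedBox v (k + m)) ω a₂) ∧
        (∃ b ∈ innerBoundary (zdGraph d) (shiftedBox v (k + m)),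
          b ∈ siteClusterIn (zdGraph d) ↑(shiftedBox v (k + m)) ω a₁) ∧
        (∃ b ∈ innerBoundary (zdGraph d) (shiftedBox v (k + m)),
          b ∈ siteClusterIn (zdGraph d) ↑(shiftedBox v (k + m)) ω a₂)) :
    SiteConfig.relabel (zdShiftIso (-v)).toEquiv ω ∈ siteTwoArmsBox d k m := by
  set φ := zdShiftIso (d := d) (-v) with hφ
  have hS : (↑(box d (k + m)) : Set (Site d)) = φ '' ↑(shiftedBox v (k + m)) := by
    rw [hφ, image_zdShiftIso_shiftedBox, add_neg_cancel, shiftedBox_zero]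
  have hcl : ∀ t, siteClusterIn (zdGraph d) ↑(box d (k + m))
      (SiteConfig.relabel φ.toEquiv ω) (φ t) =
      φ '' siteClusterIn (zdGraph d) ↑(shiftedBox v (k + m)) ω t := by
    intro t; rw [hS]; exact siteClusterIn_relabel φ _ ω t
  obtain ⟨hdisj, ⟨b₁, hb₁, hb₁c⟩, ⟨b₂, hb₂, hb₂c⟩⟩ := h
  have hmem : ∀ {a : Site d}, a ∈ shiftedBox v k → φ a ∈ box d k := by
    intro a ha
    rw [mem_shiftedBox_iff] at ha
    rw [hφ, zdShiftIso_apply, ← sub_eq_add_neg]; exact ha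
  refine ⟨φ a₁, hmem ha₁, φ a₂, hmem ha₂, ?_, ⟨φ b₁, ?_, ?_⟩, ⟨φ b₂, ?_, ?_⟩⟩
  · rw [hcl, hcl]; exact (Set.disjoint_image_iff φ.injective).2 hdisj
  · exact map_mem_innerBoundary φ hS hb₁
  · rw [hcl]; exact Set.mem_image_of_mem _ hb₁c
  · exact map_mem_innerBoundary φ hS hb₂
  · rw [hcl]; exact Set.mem_image_of_mem _ hb₂c

/-- `|∂ⁱⁿ(v + Λ(k))| ≤ |∂ⁱⁿΛ(k)|` (translation). [folklore] -/
theorem card_innerBoundary_shiftedBox_le (v : Site d) (k : ℕ) :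
    #(innerBoundary (zdGraph d) (shiftedBox v k)) ≤ #(innerBoundary (zdGraph d) (box d k)) := by
  set φ := zdShiftIso (d := d) (-v) with hφ
  have hS : (↑(box d k) : Set (Site d)) = φ '' ↑(shiftedBox v k) := by
    rw [hφ, image_zdShiftIso_shiftedBox, add_neg_cancel, shiftedBox_zero]
  exact Finset.card_le_card_of_injOn φ (fun w hw => map_mem_innerBoundary φ hS hw)
    φ.injective.injOn

/-- `v + Λ(k) ⊆ v + Λ(k + m)`. [folklore] -/
theorem shiftedBox_subset_shiftedBox_add (v : Site d) (k m : ℕ) :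
    shiftedBox v k ⊆ shiftedBox v (k + m) := by
  intro t ht
  rw [mem_shiftedBox_iff] at ht ⊢
  exact box_mono d (Nat.le_add_right k m) ht

/-- **The pointwise bound of §8** (p. 13: "`|𝒞| ≤` (number of good boxes) `+ |∂ⁱⁿΛ(k)| ×`
(number of bad boxes)", the good boxes bounded by `|I|`): for a covering `(v + Λ(k))_{v ∈ I}` of
`∂ⁱⁿΛ` with `v + Λ(k+m) ⊆ L`,
`|𝒞| ≤ |I| + |∂ⁱⁿΛ(k)| Σ_{v ∈ I} 1{ω − v ∈ two-arms(Λ(k), m)}`. [cite: Cerf2015, §8 p. 13] -/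
theorem card_reachingClusters_le {L Λ : Finset (Site d)} (hΛL : Λ ⊆ L) {k m : ℕ}
    {I : Finset (Site d)} (hIW : ∀ v ∈ I, shiftedBox v (k + m) ⊆ L)
    (hcov : ∀ x ∈ innerBoundary (zdGraph d) Λ, ∃ v ∈ I, x ∈ shiftedBox v k)
    (ω : SiteConfig (Site d)) :
    (#(reachingClusters (zdGraph d) L Λ ω) : ℝ) ≤
      #I + #(innerBoundary (zdGraph d) (box d k)) *
        ∑ v ∈ I, (SiteConfig.relabel (zdShiftIso (-v)).toEquiv ⁻¹' siteTwoArmsBox d k m).indicator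
          (fun _ => (1 : ℝ)) ω := by
  classical
  set RC := reachingClusters (zdGraph d) L Λ ω with hRC
  set K := #(innerBoundary (zdGraph d) (box d k)) with hK
  set cnt : Site d → ℕ := fun v => #(RC.filter fun C => (C ∩ shiftedBox v k).Nonempty)
    with hcnt
  have h1 : #RC ≤ ∑ v ∈ I, cnt v := by
    have hsub : RC ⊆ I.biUnion fun v => RC.filter fun C => (C ∩ shiftedBox v k).Nonempty := by
      intro C hC
      obtain ⟨b, hb, hbC⟩ := exists_mem_innerBoundary_of_mem_reachingClusters' hΛL hC
      obtain ⟨v, hv, hbv⟩ := hcov b hb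
      rw [Finset.mem_biUnion]
      exact ⟨v, hv, Finset.mem_filter.2 ⟨hC, b, Finset.mem_inter.2 ⟨hbC, hbv⟩⟩⟩
    exact (Finset.card_le_card hsub).trans Finset.card_biUnion_le
  have h2 : ∀ v ∈ I, (cnt v : ℝ) ≤ 1 + K *
      (SiteConfig.relabel (zdShiftIso (-v)).toEquiv ⁻¹' siteTwoArmsBox d k m).indicator
        (fun _ => (1 : ℝ)) ω := by
    intro v hv
    by_cases hbad : ω ∈ SiteConfig.relabel (zdShiftIso (-v)).toEquiv ⁻¹' siteTwoArmsBox d k m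
    · rw [Set.indicator_of_mem hbad, mul_one]
      have hBL : shiftedBox v k ⊆ L := (shiftedBox_subset_shiftedBox_add v k m).trans (hIW v hv)
      have h : cnt v ≤ K :=
        (card_filter_meets_le hBL).trans (card_innerBoundary_shiftedBox_le v k)
      have h' : (cnt v : ℝ) ≤ K := by exact_mod_cast h
      linarith
    · rw [Set.indicator_of_notMem hbad, mul_zero, add_zero]
      have h : cnt v ≤ 1 := by
        refine Finset.card_le_one.2 fun C₁ hC₁ C₂ hC₂ => ?_
        by_contra hne
        rw [Finset.mem_filter] at hC₁ hC₂
        obtain ⟨a₁, ha₁⟩ := hC₁.2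
        obtain ⟨a₂, ha₂⟩ := hC₂.2
        rw [Finset.mem_inter] at ha₁ ha₂
        exact hbad (relabel_mem_siteTwoArmsBox ha₁.2 ha₂.2
          (twoArms_of_two_mem_reachingClusters hC₁.1 hC₂.1 hne (hIW v hv) ha₁.1
            (shiftedBox_subset_shiftedBox_add v k m ha₁.2) ha₂.1
            (shiftedBox_subset_shiftedBox_add v k m ha₂.2)))
      exact_mod_cast h
  calc (#RC : ℝ) ≤ ((∑ v ∈ I, cnt v : ℕ) : ℝ) := by exact_mod_cast h1
    _ = ∑ v ∈ I, (cnt v : ℝ) := by push_cast; rfl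
    _ ≤ ∑ v ∈ I, (1 + K * (SiteConfig.relabel (zdShiftIso (-v)).toEquiv ⁻¹'
          siteTwoArmsBox d k m).indicator (fun _ => (1 : ℝ)) ω) := Finset.sum_le_sum h2
    _ = #I + K * ∑ v ∈ I, (SiteConfig.relabel (zdShiftIso (-v)).toEquiv ⁻¹'
          siteTwoArmsBox d k m).indicator (fun _ => (1 : ℝ)) ω := by
        rw [Finset.sum_add_distrib, Finset.sum_const, nsmul_eq_mul, mul_one, Finset.mul_sum]

end Pointwise

/-! ### Step 4: expectations (`E(√|𝒞|) ≤ E(|𝒞|)^{1/2}`) -/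

section Expectation

/-- `√x ≤ x/(2M) + M/2` for `M > 0` and `x ≥ 0` (from `(√x − M)² ≥ 0`). [folklore] -/
theorem sqrt_le_div_add_of_pos {x M : ℝ} (hM : 0 < M) (hx : 0 ≤ x) :
    Real.sqrt x ≤ x / (2 * M) + M / 2 := by
  have h2M : 0 < 2 * M := by positivity
  rw [div_add_div _ _ h2M.ne' two_ne_zero, le_div_iff₀ (by positivity)]
  nlinarith [sq_nonneg (Real.sqrt x - M), Real.sq_sqrt hx, Real.sqrt_nonneg x]

/-- **`E(√N) ≤ √B`** when `N ≤ A + K Σ_{i ∈ I} 1_{S_i}` pointwise, `P(S_i) = q` for all `i` and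
`A + K |I| q ≤ B`: the elementary form (`√N ≤ N/(2M) + M/2` with `M = √B`) of the step
"`E(√|𝒞|) ≤ E(|𝒞|)^{1/2}`" of §8 (p. 13). No measurability of `N` or of the `S_i` is needed
(the `S_i` are replaced by measurable hulls). [cite: Cerf2015, §8 p. 13] -/
theorem integral_sqrt_le_sqrt_of_le_indicator_sum {Ω : Type*} [MeasurableSpace Ω]
    (μ : Measure Ω) [IsProbabilityMeasure μ] {ι : Type*} (I : Finset ι) (S : ι → Set Ω)
    (N : Ω → ℝ) {A K q B : ℝ} (hN : ∀ ω, 0 ≤ N ω) (hK : 0 ≤ K)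
    (hle : ∀ ω, N ω ≤ A + K * ∑ i ∈ I, (S i).indicator (fun _ => (1 : ℝ)) ω)
    (hS : ∀ i ∈ I, μ.real (S i) = q) (hB : 0 < B) (hAB : A + K * (#I * q) ≤ B) :
    ∫ ω, Real.sqrt (N ω) ∂μ ≤ Real.sqrt B := by
  classical
  set M := Real.sqrt B with hM
  have hMpos : 0 < M := Real.sqrt_pos.2 hB
  set T : ι → Set Ω := fun i => toMeasurable μ (S i) with hT
  set g : Ω → ℝ := fun ω =>
    (A + K * ∑ i ∈ I, (T i).indicator (fun _ => (1 : ℝ)) ω) / (2 * M) + M / 2 with hg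
  have hind_le : ∀ i ω, (S i).indicator (fun _ => (1 : ℝ)) ω ≤ (T i).indicator (fun _ => (1 : ℝ)) ω :=
    fun i ω => Set.indicator_le_indicator_of_subset (subset_toMeasurable μ (S i))
      (fun _ => zero_le_one) ω
  have hptw : ∀ ω, Real.sqrt (N ω) ≤ g ω := by
    intro ω
    refine (sqrt_le_div_add_of_pos hMpos (hN ω)).trans ?_
    have h1 : N ω ≤ A + K * ∑ i ∈ I, (T i).indicator (fun _ => (1 : ℝ)) ω :=
      (hle ω).trans (add_le_add_right
        (mul_le_mul_of_nonneg_left (Finset.sum_le_sum fun i _ => hind_le i ω) hK) A)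
    simp only [hg]
    gcongr
  have hTi : ∀ i, Integrable ((T i).indicator fun _ => (1 : ℝ)) μ := fun i =>
    (integrable_const (1 : ℝ)).indicator (measurableSet_toMeasurable μ (S i))
  have hsum : Integrable (fun ω => ∑ i ∈ I, (T i).indicator (fun _ => (1 : ℝ)) ω) μ :=
    integrable_finsetSum I fun i _ => hTi i
  have hgi : Integrable g μ :=
    (((integrable_const A).add (hsum.const_mul K)).div_const _).add (integrable_const _)
  have hTreal : ∀ i ∈ I, μ.real (T i) = q := by
    intro i hi
    rw [hT, measureReal_def, measure_toMeasurable, ← measureReal_def, hS i hi]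
  have hint : ∫ ω, g ω ∂μ = (A + K * (#I * q)) / (2 * M) + M / 2 := by
    simp only [hg]
    rw [integral_add _ (integrable_const _), integral_div,
      integral_add (integrable_const A) (hsum.const_mul K), integral_const_mul,
      integral_finsetSum I (fun i _ => hTi i)]
    · simp only [integral_const, probReal_univ, smul_eq_mul, one_mul]
      congr 2
      rw [Finset.sum_congr rfl fun i hi => by
        rw [integral_indicator_const _ (measurableSet_toMeasurable μ (S i)), smul_eq_mul, mul_one]]
      rw [Finset.sum_congr rfl hTreal, Finset.sum_const, nsmul_eq_mul]
    · exact ((integrable_const A).add (hsum.const_mul K)).div_const _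
  calc ∫ ω, Real.sqrt (N ω) ∂μ ≤ ∫ ω, g ω ∂μ :=
        integral_mono_of_nonneg (Filter.Eventually.of_forall fun ω => Real.sqrt_nonneg _) hgi
          (Filter.Eventually.of_forall hptw)
    _ = (A + K * (#I * q)) / (2 * M) + M / 2 := hint
    _ ≤ B / (2 * M) + M / 2 := by gcongr
    _ = M := by
        have hB' : B = M * M := by rw [hM, Real.mul_self_sqrt hB.le]
        rw [hB']; field_simp; ring

end Expectation

/-! ### Step 5: the analytic assembly (§8 p. 13 bottom, §9 p. 14 top) -/

section Assembly

/-- The exponent bookkeeping `(4d − 2) + 2(d−1)d = 2d² + 2d − 2` of p. 13–14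
(`n^{4d−2+2(d−1)d}` from Cor. 7.2 and Lemma 6.1). [cite: Cerf2015, §9 p. 14] -/
theorem cerf_exponent_eq (hd : 1 ≤ d) : 4 * d - 2 + 2 * (d - 1) * d = 2 * d ^ 2 + 2 * d - 2 := by
  have h1 : 2 ≤ 4 * d := by omega
  have h2 : 2 ≤ 2 * d ^ 2 + 2 * d := by nlinarith
  zify [h1, h2, hd]
  ring

/-- `n^m e^{−2a (ln n)²} ≤ e^{m²/(8a)}` for `a > 0`, `n ≥ 1`: the second term of Lemma 5.1 is
super-polynomially small (absorbed into the constant in the last display of §8).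
[cite: Cerf2015, §8 p. 13] -/
theorem pow_mul_exp_neg_log_sq_le {a : ℝ} (ha : 0 < a) (m : ℕ) {n : ℕ} (hn : 1 ≤ n) :
    (n : ℝ) ^ m * Real.exp (-2 * Real.log n ^ 2 * a) ≤ Real.exp ((m : ℝ) ^ 2 / (8 * a)) := by
  have hn0 : (0 : ℝ) < n := by exact_mod_cast hn
  have h1 : (n : ℝ) ^ m = Real.exp (m * Real.log n) := by
    rw [Real.exp_nat_mul, Real.exp_log hn0]
  rw [h1, ← Real.exp_add, Real.exp_le_exp]
  have key : (m : ℝ) * Real.log n + -2 * Real.log n ^ 2 * a =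
      (m : ℝ) ^ 2 / (8 * a) - 2 * a * (Real.log n - m / (4 * a)) ^ 2 := by
    field_simp
    ring
  rw [key]
  nlinarith [sq_nonneg (Real.log n - m / (4 * a))]

/-- **The second term of Lemma 5.1 is `O(n^{−d})`**: for `n ≥ 2` and `a > 0`,
`|Λ(n+1)|² e^{−2a(ln n)²} ≤ 16^d e^{(3d)²/(8a)} / n^d` (`|Λ(n+1)| = (2n+3)^d ≤ (4n)^d` and
`pow_mul_exp_neg_log_sq_le` with `m = 3d`). [cite: Cerf2015, §8 p. 13] -/
theorem card_box_sq_mul_exp_le {a : ℝ} (ha : 0 < a) {n : ℕ} (hn : 2 ≤ n) :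
    ((box d (n + 1)).card : ℝ) ^ 2 * Real.exp (-2 * Real.log n ^ 2 * a) ≤
      16 ^ d * Real.exp (((3 * d : ℕ) : ℝ) ^ 2 / (8 * a)) / (n : ℝ) ^ d := by
  have hn0 : (0 : ℝ) < n := by positivity
  have hn2 : (2 : ℝ) ≤ n := by exact_mod_cast hn
  have hcard : ((box d (n + 1)).card : ℝ) ≤ (4 : ℝ) ^ d * (n : ℝ) ^ d := by
    rw [card_box, ← mul_pow]; push_cast
    gcongr
    linarith
  have hmain := pow_mul_exp_neg_log_sq_le ha (3 * d) (show 1 ≤ n by omega)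
  have hE : 0 ≤ Real.exp (-2 * Real.log n ^ 2 * a) := (Real.exp_pos _).le
  rw [le_div_iff₀ (by positivity)]
  calc ((box d (n + 1)).card : ℝ) ^ 2 * Real.exp (-2 * Real.log n ^ 2 * a) * (n : ℝ) ^ d
      ≤ ((4 : ℝ) ^ d * (n : ℝ) ^ d) ^ 2 * Real.exp (-2 * Real.log n ^ 2 * a) * (n : ℝ) ^ d := by
        gcongr
    _ = ((4 : ℝ) ^ d) ^ 2 * ((n : ℝ) ^ (3 * d) * Real.exp (-2 * Real.log n ^ 2 * a)) := by ring
    _ ≤ ((4 : ℝ) ^ d) ^ 2 * Real.exp (((3 * d : ℕ) : ℝ) ^ 2 / (8 * a)) := by gcongr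
    _ = 16 ^ d * Real.exp (((3 * d : ℕ) : ℝ) ^ 2 / (8 * a)) := by
        congr 1
        rw [← pow_mul, mul_comm, pow_mul]; norm_num

/-- Absorbing an `O(n^{−d})` term into the right-hand side of the recursion: for `C, X ≥ 0`,
`n ≥ 2` and `1 ≤ k ≤ n`, `C/n^d ≤ (C/ln 2) (ln n/√n) (k^{−(d−1)} + X)^{1/2}`
(as `ln n ≥ ln 2`, `k^{−(d−1)} ≥ n^{−(d−1)}` and `√(n^d) ≤ n^d`). [cite: Cerf2015, §8 p. 13] -/
theorem div_pow_le_log_div_sqrt_mul_sqrt (hd : 1 ≤ d) {C X : ℝ} (hC : 0 ≤ C) (hX : 0 ≤ X)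
    {n k : ℕ} (hn : 2 ≤ n) (hk : 1 ≤ k) (hkn : k ≤ n) :
    C / (n : ℝ) ^ d ≤
      C / Real.log 2 * Real.log n / Real.sqrt n * Real.sqrt (1 / (k : ℝ) ^ (d - 1) + X) := by
  have hn0 : (0 : ℝ) < n := by positivity
  have hk0 : (0 : ℝ) < k := by exact_mod_cast hk
  have hkn' : (k : ℝ) ≤ n := by exact_mod_cast hkn
  have hlog2 : 0 < Real.log 2 := Real.log_pos one_lt_two
  have hlogn : Real.log 2 ≤ Real.log n := Real.log_le_log two_pos (by exact_mod_cast hn)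
  have h1 : C ≤ C / Real.log 2 * Real.log n := by
    rw [div_mul_eq_mul_div, le_div_iff₀ hlog2]
    exact mul_le_mul_of_nonneg_left hlogn hC
  have h2 : 1 / Real.sqrt ((n : ℝ) ^ (d - 1)) ≤ Real.sqrt (1 / (k : ℝ) ^ (d - 1) + X) := by
    rw [one_div, ← Real.sqrt_inv, inv_eq_one_div]
    apply Real.sqrt_le_sqrt
    have : 1 / (n : ℝ) ^ (d - 1) ≤ 1 / (k : ℝ) ^ (d - 1) := by
      apply one_div_le_one_div_of_le (by positivity)
      gcongr
    linarith
  have hsq : Real.sqrt ((n : ℝ) ^ (d - 1)) * Real.sqrt n = Real.sqrt ((n : ℝ) ^ d) := by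
    rw [← Real.sqrt_mul (by positivity), ← pow_succ, Nat.sub_add_cancel hd]
  have hsqle : Real.sqrt ((n : ℝ) ^ d) ≤ (n : ℝ) ^ d := by
    rw [Real.sqrt_le_left (by positivity)]
    have h1' : (1 : ℝ) ≤ (n : ℝ) ^ d := one_le_pow₀ (by linarith [show (2 : ℝ) ≤ n by exact_mod_cast hn])
    nlinarith
  have hsqpos : 0 < Real.sqrt ((n : ℝ) ^ d) := Real.sqrt_pos.2 (by positivity)
  calc C / (n : ℝ) ^ d ≤ C / Real.sqrt ((n : ℝ) ^ d) :=
        div_le_div_of_nonneg_left hC hsqpos hsqle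
    _ = C * (1 / Real.sqrt ((n : ℝ) ^ (d - 1)) / Real.sqrt n) := by
        rw [← hsq]; field_simp
    _ ≤ C / Real.log 2 * Real.log n * (Real.sqrt (1 / (k : ℝ) ^ (d - 1) + X) / Real.sqrt n) := by
        apply mul_le_mul h1 _ (by positivity) (hC.trans h1)
        exact div_le_div_of_nonneg_right h2 (Real.sqrt_nonneg _)
    _ = C / Real.log 2 * Real.log n / Real.sqrt n * Real.sqrt (1 / (k : ℝ) ^ (d - 1) + X) := by
        ring

/-- The first term of Lemma 5.1 with `E(√|𝒞|) ≤ (c n^{d−1} Q)^{1/2}`: since `|Λ(n)| ≥ n^d`,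
`(2d ln n/√|Λ(n)|) (c n^{d−1} Q)^{1/2} ≤ 2d √c (ln n/√n) √Q`. [cite: Cerf2015, §8 p. 13] -/
theorem first_term_le (hd : 1 ≤ d) {c : ℝ} (Q : ℝ) (hc : 0 ≤ c) {n : ℕ} (hn : 1 ≤ n) :
    2 * d * Real.log n / Real.sqrt ((box d n).card : ℝ) * Real.sqrt (c * (n : ℝ) ^ (d - 1) * Q) ≤
      2 * d * Real.sqrt c * Real.log n / Real.sqrt n * Real.sqrt Q := by
  have hn0 : (0 : ℝ) < n := by exact_mod_cast hn
  have hlog : 0 ≤ Real.log n := Real.log_nonneg (by exact_mod_cast hn)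
  have hcard : (n : ℝ) ^ d ≤ ((box d n).card : ℝ) := by
    rw [card_box]; push_cast
    gcongr
    linarith
  have hs : Real.sqrt ((n : ℝ) ^ (d - 1)) * Real.sqrt n ≤ Real.sqrt ((box d n).card : ℝ) := by
    rw [← Real.sqrt_mul (by positivity), ← pow_succ, Nat.sub_add_cancel hd]
    exact Real.sqrt_le_sqrt hcard
  have hspos : 0 < Real.sqrt ((n : ℝ) ^ (d - 1)) := Real.sqrt_pos.2 (by positivity)
  have hsn : 0 < Real.sqrt (n : ℝ) := Real.sqrt_pos.2 hn0
  rw [show Real.sqrt (c * (n : ℝ) ^ (d - 1) * Q) =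
      Real.sqrt c * Real.sqrt ((n : ℝ) ^ (d - 1)) * Real.sqrt Q by
    rw [Real.sqrt_mul (by positivity), Real.sqrt_mul hc]]
  set s := Real.sqrt ((n : ℝ) ^ (d - 1)) with hs_def
  set A := 2 * d * Real.sqrt c * Real.log n * Real.sqrt Q with hA
  have hA0 : 0 ≤ A := by positivity
  calc 2 * d * Real.log n / Real.sqrt ((box d n).card : ℝ) * (Real.sqrt c * s * Real.sqrt Q)
      = A * s / Real.sqrt ((box d n).card : ℝ) := by simp only [hA]; ring
    _ ≤ A * s / (s * Real.sqrt n) :=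
        div_le_div_of_nonneg_left (by positivity) (by positivity) hs
    _ = A / Real.sqrt n := by
        rw [mul_comm s, mul_div_mul_right _ _ hspos.ne']
    _ = 2 * d * Real.sqrt c * Real.log n / Real.sqrt n * Real.sqrt Q := by
        simp only [hA]; ring

/-- **Cerf 2015, the recursive inequality of §8–§9 from its inputs**: the central inequality
(Lemma 5.1, with `ℓ = n`), the box two-arms bound (Cor. 7.2) and the connection lower bound
(Lemma 6.1 in its `θ(p) > 0` form) imply `Cerf2015_sec9_recursion`, by the covering argument
of §8 (`exists_boxCovering`, `card_reachingClusters_le`), `E(√|𝒞|) ≤ E(|𝒞|)^{1/2}`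
(`integral_sqrt_le_sqrt_of_le_indicator_sum`), translation invariance, and the absorption of
the second term of Lemma 5.1 (`card_box_sq_mul_exp_le`). [cite: Cerf2015, §8–§9 (p. 12–14)] -/
theorem Cerf2015_sec9_recursion_of_lemmas (h51 : Cerf2015_lem_5_1) (h72 : Cerf2015_cor_7_2)
    (h61 : Cerf2015_lem_6_1_of_siteTheta_pos) : Cerf2015_sec9_recursion := by
  intro d hd p hθ hp1
  have hd1 : 1 ≤ d := by omega
  have hp0 : 0 < (p : ℝ) := pos_of_siteTheta_pos (zdGraph d) 0 p hθ
  obtain ⟨C₇, hC₇⟩ := h72 d hd p hp0 hp1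
  obtain ⟨c₆, hc₆, h6⟩ := h61 d hd p hθ
  -- the constants
  set C₇' : ℝ := max C₇ 1 with hC₇'
  have hC₇'pos : 0 < C₇' := lt_of_lt_of_le one_pos (le_max_right _ _)
  set D : ℝ := 2 * d * 3 ^ (d - 1) * C₇' / c₆ with hD
  have hD0 : 0 ≤ D := by positivity
  set c₃ : ℝ := 2 * d * 6 ^ (d - 1) * (1 + D) with hc₃
  have hc₃pos : 0 < c₃ := by positivity
  set a : ℝ := (p : ℝ) ^ 2 * (1 - p) ^ 2 with ha
  have h1p : 0 < 1 - (p : ℝ) := by linarith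
  have hapos : 0 < a := by positivity
  set CT : ℝ := 4 * d / ((p : ℝ) * (1 - p)) *
    (16 ^ d * Real.exp (((3 * d : ℕ) : ℝ) ^ 2 / (8 * a))) with hCT
  have hCT0 : 0 ≤ CT := by positivity
  refine ⟨2 * d * Real.sqrt c₃ + CT / Real.log 2, ?_⟩
  intro n k hn hk hkn
  have hn1 : 1 ≤ n := by omega
  have hn0 : (0 : ℝ) < n := by positivity
  have hk0 : (0 : ℝ) < k := by exact_mod_cast hk
  -- abbreviations
  set P2 : ℝ := (sitePercolation (Site d) p).real (siteTwoArms d 0 (n - k - 2)) with hP2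
  have hP2nn : 0 ≤ P2 := measureReal_nonneg
  set e : ℕ := 2 * d ^ 2 + 2 * d - 2 with he
  set Q : ℝ := 1 / (k : ℝ) ^ (d - 1) + (k : ℝ) ^ e * P2 with hQ
  have hQpos : 0 < Q := by positivity
  -- Cor. 7.2 and Lemma 6.1 for the bad boxes: `q ≤ (C₇'/c₆) k^e P(two-arms(0, n-k-2))`
  set q : ℝ := (sitePercolation (Site d) p).real (siteTwoArmsBox d k (n - 1)) with hq
  have hq0 : 0 ≤ q := measureReal_nonneg
  have h6k : ∀ a ∈ innerBoundary (zdGraph d) (box d k), ∀ b ∈ innerBoundary (zdGraph d) (box d k),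
      c₆ / (k : ℝ) ^ (2 * (d - 1) * d) ≤
        (sitePercolation (Site d) p).real (siteConnIn (zdGraph d) ↑(box d (2 * k)) a b) :=
    fun a ha b hb => h6 k hk a (mem_innerBoundary_iff.1 ha).1 b (mem_innerBoundary_iff.1 hb).1
  have h72k := hC₇ k hk (n - 1) (by omega) _ h6k
  rw [show n - 1 - k - 1 = n - k - 2 by omega] at h72k
  have hpow : (k : ℝ) ^ (4 * d - 2) * (k : ℝ) ^ (2 * (d - 1) * d) = (k : ℝ) ^ e := by
    rw [← pow_add, cerf_exponent_eq hd1]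
  have hq_le : q ≤ C₇' / c₆ * (k : ℝ) ^ e * P2 := by
    have hkpow : (0 : ℝ) < (k : ℝ) ^ (2 * (d - 1) * d) := by positivity
    have h1 : q * c₆ ≤ C₇' * (k : ℝ) ^ e * P2 :=
      calc q * c₆ = q * (c₆ / (k : ℝ) ^ (2 * (d - 1) * d)) * (k : ℝ) ^ (2 * (d - 1) * d) := by
            field_simp
        _ ≤ C₇ * (k : ℝ) ^ (4 * d - 2) *
              (sitePercolation (Site d) p).real (siteTwoArms d 0 (n - k - 2)) *
              (k : ℝ) ^ (2 * (d - 1) * d) :=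
            mul_le_mul_of_nonneg_right h72k hkpow.le
        _ ≤ C₇' * (k : ℝ) ^ (4 * d - 2) * P2 * (k : ℝ) ^ (2 * (d - 1) * d) := by
            gcongr
            exact le_max_left _ _
        _ = C₇' * ((k : ℝ) ^ (4 * d - 2) * (k : ℝ) ^ (2 * (d - 1) * d)) * P2 := by ring
        _ = C₇' * (k : ℝ) ^ e * P2 := by rw [hpow]
    rw [show C₇' / c₆ * (k : ℝ) ^ e * P2 = C₇' * (k : ℝ) ^ e * P2 / c₆ by ring, le_div_iff₀ hc₆]
    exact h1
  -- the covering of `∂ⁱⁿΛ(n+1)` by translates of `Λ(k)` and the pointwise bound on `|𝒞|`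
  obtain ⟨I, hIbox, hcov, hIcard⟩ := exists_boxCovering hd1 (N := n + 1) (k := k) hk (by omega)
  have hIW : ∀ v ∈ I, shiftedBox v (k + (n - 1)) ⊆ box d (n + n) := by
    intro v hv
    have h := shiftedBox_subset_box (m := k + (n - 1)) (hIbox v hv)
    rwa [show n + 1 - k + (k + (n - 1)) = n + n by omega] at h
  have hΛL : box d (n + 1) ⊆ box d (n + n) := box_mono d (by omega)
  have hptw := card_reachingClusters_le hΛL hIW hcov
  set K : ℕ := #(innerBoundary (zdGraph d) (box d k)) with hK
  -- sizes: `|I| ≤ 2d 6^{d-1} n^{d-1}/k^{d-1}`, `K ≤ 2d 3^{d-1} k^{d-1}`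
  have hn1r : (1 : ℝ) ≤ n := by exact_mod_cast hn1
  have hk1r : (1 : ℝ) ≤ k := by exact_mod_cast hk
  have hIle : (#I : ℝ) ≤ 2 * d * 6 ^ (d - 1) * (n : ℝ) ^ (d - 1) / (k : ℝ) ^ (d - 1) := by
    calc (#I : ℝ) ≤ 2 * d * (3 * ((n + 1 : ℕ) : ℝ) / k) ^ (d - 1) := hIcard
      _ ≤ 2 * d * (6 * (n : ℝ) / k) ^ (d - 1) := by
          push_cast
          have h36 : 3 * ((n : ℝ) + 1) / k ≤ 6 * (n : ℝ) / k :=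
            div_le_div_of_nonneg_right (by linarith) hk0.le
          exact mul_le_mul_of_nonneg_left (pow_le_pow_left₀ (by positivity) h36 _)
            (by positivity)
      _ = 2 * d * 6 ^ (d - 1) * (n : ℝ) ^ (d - 1) / (k : ℝ) ^ (d - 1) := by
          rw [div_pow, mul_pow]; ring
  have hKle : (K : ℝ) ≤ 2 * d * 3 ^ (d - 1) * (k : ℝ) ^ (d - 1) := by
    have h := card_innerBoundary_box_le (d := d) k
    calc (K : ℝ) ≤ ((2 * d * (2 * k + 1) ^ (d - 1) : ℕ) : ℝ) := by exact_mod_cast h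
      _ = 2 * d * (2 * (k : ℝ) + 1) ^ (d - 1) := by push_cast; ring
      _ ≤ 2 * d * (3 * (k : ℝ)) ^ (d - 1) := by
          gcongr
          linarith
      _ = 2 * d * 3 ^ (d - 1) * (k : ℝ) ^ (d - 1) := by rw [mul_pow]; ring
  have hKq : (K : ℝ) * q ≤ D * (k : ℝ) ^ (d - 1) * ((k : ℝ) ^ e * P2) :=
    calc (K : ℝ) * q ≤ (2 * d * 3 ^ (d - 1) * (k : ℝ) ^ (d - 1)) * (C₇' / c₆ * (k : ℝ) ^ e * P2) :=
          mul_le_mul hKle hq_le hq0 (by positivity)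
      _ = D * (k : ℝ) ^ (d - 1) * ((k : ℝ) ^ e * P2) := by simp only [hD]; ring
  have hAB : (#I : ℝ) + K * (#I * q) ≤ c₃ * (n : ℝ) ^ (d - 1) * Q := by
    have hkp : (0 : ℝ) < (k : ℝ) ^ (d - 1) := by positivity
    have hX : 0 ≤ (k : ℝ) ^ e * P2 := by positivity
    have hu : 0 ≤ D * (1 / (k : ℝ) ^ (d - 1)) := by positivity
    calc (#I : ℝ) + K * (#I * q) = #I * (1 + K * q) := by ring
      _ ≤ (2 * d * 6 ^ (d - 1) * (n : ℝ) ^ (d - 1) / (k : ℝ) ^ (d - 1)) *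
            (1 + D * (k : ℝ) ^ (d - 1) * ((k : ℝ) ^ e * P2)) :=
          mul_le_mul hIle (by linarith [hKq]) (by positivity) (by positivity)
      _ = 2 * d * 6 ^ (d - 1) * (n : ℝ) ^ (d - 1) *
            (1 / (k : ℝ) ^ (d - 1) + D * ((k : ℝ) ^ e * P2)) := by
          field_simp
      _ ≤ 2 * d * 6 ^ (d - 1) * (n : ℝ) ^ (d - 1) * ((1 + D) * Q) := by
          apply mul_le_mul_of_nonneg_left _ (by positivity)
          simp only [hQ]
          nlinarith [hu, hX]
      _ = c₃ * (n : ℝ) ^ (d - 1) * Q := by simp only [hc₃]; ring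
  -- `E(√|𝒞|) ≤ (c₃ n^{d-1} Q)^{1/2}` (translation invariance for the bad boxes)
  have hint : ∫ ω, Real.sqrt
      ((reachingClusters (zdGraph d) (box d (n + n)) (box d (n + 1)) ω).card : ℝ)
        ∂(sitePercolation (Site d) p) ≤ Real.sqrt (c₃ * (n : ℝ) ^ (d - 1) * Q) := by
    refine integral_sqrt_le_sqrt_of_le_indicator_sum (sitePercolation (Site d) p) I
      (fun v => SiteConfig.relabel (zdShiftIso (-v)).toEquiv ⁻¹' siteTwoArmsBox d k (n - 1))
      (fun ω => ((reachingClusters (zdGraph d) (box d (n + n)) (box d (n + 1)) ω).card : ℝ))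
      (fun ω => Nat.cast_nonneg _) (Nat.cast_nonneg K) hptw ?_ (by positivity) hAB
    intro v _
    exact sitePercolation_real_preimage_relabel _ p _
  -- Lemma 5.1 with `ℓ = n` and the two terms
  have h51n := h51 d hd p hp0 hp1 n n hn1 (by omega)
  rw [show 2 * n + n = 3 * n by ring] at h51n
  have hlog0 : 0 ≤ Real.log n := Real.log_nonneg hn1r
  have hT1 : 2 * d * Real.log n / Real.sqrt ((box d n).card : ℝ) *
      ∫ ω, Real.sqrt ((reachingClusters (zdGraph d) (box d (n + n)) (box d (n + 1)) ω).card : ℝ)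
        ∂(sitePercolation (Site d) p) ≤
      2 * d * Real.sqrt c₃ * Real.log n / Real.sqrt n * Real.sqrt Q :=
    calc _ ≤ 2 * d * Real.log n / Real.sqrt ((box d n).card : ℝ) *
          Real.sqrt (c₃ * (n : ℝ) ^ (d - 1) * Q) :=
          mul_le_mul_of_nonneg_left hint (by positivity)
      _ ≤ _ := first_term_le hd1 Q hc₃pos.le hn1
  have hT2 : 4 * d / ((p : ℝ) * (1 - p)) * ((box d (n + 1)).card : ℝ) ^ 2 *
      Real.exp (-2 * Real.log n ^ 2 * (p : ℝ) ^ 2 * (1 - p) ^ 2) ≤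
      CT / Real.log 2 * Real.log n / Real.sqrt n * Real.sqrt Q := by
    have hexp : Real.exp (-2 * Real.log n ^ 2 * (p : ℝ) ^ 2 * (1 - p) ^ 2) =
        Real.exp (-2 * Real.log n ^ 2 * a) := by
      simp only [ha]; ring_nf
    have h2 := card_box_sq_mul_exp_le (d := d) hapos hn
    calc 4 * d / ((p : ℝ) * (1 - p)) * ((box d (n + 1)).card : ℝ) ^ 2 *
          Real.exp (-2 * Real.log n ^ 2 * (p : ℝ) ^ 2 * (1 - p) ^ 2)
        = 4 * d / ((p : ℝ) * (1 - p)) *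
            (((box d (n + 1)).card : ℝ) ^ 2 * Real.exp (-2 * Real.log n ^ 2 * a)) := by
          rw [hexp]; ring
      _ ≤ 4 * d / ((p : ℝ) * (1 - p)) *
            (16 ^ d * Real.exp (((3 * d : ℕ) : ℝ) ^ 2 / (8 * a)) / (n : ℝ) ^ d) :=
          mul_le_mul_of_nonneg_left h2 (by positivity)
      _ = CT / (n : ℝ) ^ d := by simp only [hCT]; ring
      _ ≤ CT / Real.log 2 * Real.log n / Real.sqrt n * Real.sqrt Q := by
          simp only [hQ]
          exact div_pow_le_log_div_sqrt_mul_sqrt hd1 hCT0 (by positivity) hn hk (by omega)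
  calc (sitePercolation (Site d) p).real (siteTwoArms d 0 (3 * n)) ≤ _ := h51n
    _ ≤ 2 * d * Real.sqrt c₃ * Real.log n / Real.sqrt n * Real.sqrt Q +
          CT / Real.log 2 * Real.log n / Real.sqrt n * Real.sqrt Q := add_le_add hT1 hT2
    _ = (2 * d * Real.sqrt c₃ + CT / Real.log 2) * Real.log n / Real.sqrt n * Real.sqrt Q := by
        ring

end Assembly

end CritPerc

end Literature.Probability.Percolation
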